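import Mathlib
import HarnessLib
import Summits.AtomisticToContinuum.BoseEinsteinCondensation.Theses.BECFisherTransfer
import Summits.AtomisticToContinuum.BoseEinsteinCondensation.Theorems.BECFisherTransferTrialDriftFisherBoundJastrowEnergy
import Summits.AtomisticToContinuum.BoseEinsteinCondensation.Theorems.BECFisherTransferTrialDriftFisherBoundGroundStateRepresentation
import Summits.AtomisticToContinuum.BoseEinsteinCondensation.Theorems.InfraredMinimumUncertainty.Negative.FreeMinimisersConstant
import Literature.MathematicalPhysics.QuantumManyBody.LiebYngvasonTheorem
import Literature.MathematicalPhysics.QuantumManyBody.HardCoreScatteringLength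

/-!
# Route `BECFisherTransfer` — support `TrialDriftFisherBound` (stmt-AtomisticToContinuum-14306)

Closes `Summit.AtomisticToContinuum.BoseEinsteinCondensation.Theses.BECFisherTransfer.TrialDriftFisherBound`:
for every repulsive finite-range `v` there are `ρ₀ > 0` and `C` such that for `0 < ρ < ρ₀`,
eventually in `N`, every exact real positive periodic minimiser `Ψ₀` on the torus of side
`L = (N/ρ)^{1/3}` admits a normalised Bijl–Dyson–Jastrow trial state `Φ = c ∏_{i<j} φ^per(xᵢ - xⱼ)`
with `I_{cell^N}(P_Φ ‖ P_Ψ₀) ≤ C ρ a Y^{1/17} N`, `Y = 4πρa³/3`, `a` the scattering length.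

Proof (the route's sketch, all engines proved in the tree).
* `a > 0`. The explicit LSSY trial state `Φ` at the Dyson profile has
  `⟨Φ,HΦ⟩ ≤ (1 + x)·4πρ₁a(1 + 12x)N`, `x = a/b ≤ Y^{1/3}`, `ρ₁ = (N-1)/L³ ≤ ρ`
  (`TrialDriftFisher.exists_jastrow_periodicEnergy_le`, from `LSSY2005_dysonProfile_holds` and the
  product-state computation of `LSSY2005_jastrowBound_holds`); the ground-state energy is bounded
  below by `4πρa(1 - C Y^{1/17})N` (`LSSY2005_lowerBound_periodic_holds`, LSSY Thm. 2.4); and the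
  ground-state representation `⟨Φ,HΦ⟩ = E₀ + ¼ I(P_Φ‖P_Ψ₀)`
  (`TrialDriftFisher.periodicEnergy_eq_add_relativeFisherInformation`, for the positive minimiser,
  whose finite energy makes the interaction integrable on the cell) turns the difference into
  `I ≤ 16π(14 + C) ρ a Y^{1/17} N` once `Y ≤ 1` (so `Y^{1/3} ≤ Y^{1/17}`). Finiteness `a ≤ R₀` is
  `scatteringLength_le_range`; the side condition `L/a > C'Y^{-6/17}` holds eventually since
  `L = (N/ρ)^{1/3} → ∞`.
* `a = 0`. Then `v(|x|) = 0` a.e. (`LSSY2005_zeroScatteringLength_holds`), `E₀^per = 0` (product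
  state with `φ ≡ 1`), so a minimiser has zero kinetic energy and is constant
  (`InfraredMinimumUncertainty.Negative.exists_eq_const_of_kinetic_zero`); the Jastrow state with
  `φ ≡ 1` is constant too, and the relative Fisher information of two constants vanishes.

References: [LSSY2005] Lieb–Seiringer–Solovej–Yngvason 2005, Thm. 2.2, Thm. 2.4, (6.26)–(6.28);
[Dyson1957]; [OttoVillani2000].
-/

noncomputable section

open MeasureTheory Filter Set
open scoped ENNReal NNReal Topology BigOperators

namespace Summit.AtomisticToContinuum.BoseEinsteinCondensation.Theorems

open Literature.MathematicalPhysics.QuantumManyBody.BoseGas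
open Summit.AtomisticToContinuum.BoseEinsteinCondensation.Theorems.TrialDriftFisher
open Summit.AtomisticToContinuum.BoseEinsteinCondensation.Theorems.InfraredMinimumUncertainty.Negative
  (exists_eq_const_of_kinetic_zero)

namespace TrialDriftFisher

/-! ### Small real-analysis helpers -/

/-- `(t³)^{1/3} = t` for `t ≥ 0`. [folklore] -/
theorem cube_rpow_third {t : ℝ} (ht : 0 ≤ t) : (t ^ 3) ^ ((1 : ℝ) / 3) = t := by
  rw [← Real.rpow_natCast, ← Real.rpow_mul ht]
  norm_num

/-- `ofReal u - ofReal l ≤ ofReal (u - l)` in `ℝ≥0∞` (for all real `u, l`). [folklore] -/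
theorem ofReal_sub_ofReal_le (u l : ℝ) :
    ENNReal.ofReal u - ENNReal.ofReal l ≤ ENNReal.ofReal (u - l) := by
  refine tsub_le_iff_right.mpr ?_
  calc ENNReal.ofReal u = ENNReal.ofReal ((u - l) + l) := by ring_nf
    _ ≤ ENNReal.ofReal (u - l) + ENNReal.ofReal l := ENNReal.ofReal_add_le

/-- From `E₀ + ¼ I = E(Φ)`, `ofReal l ≤ E₀` and `E(Φ) ≤ ofReal u`: `I ≤ ofReal (4 (u - l))`.
[folklore] -/
theorem fisher_le_of_sandwich {E₀ E I : ℝ≥0∞} {u l : ℝ} (hE : E = E₀ + 4⁻¹ * I)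
    (hl : ENNReal.ofReal l ≤ E₀) (hu : E ≤ ENNReal.ofReal u) :
    I ≤ ENNReal.ofReal (4 * (u - l)) := by
  have h1 : ENNReal.ofReal l + 4⁻¹ * I ≤ ENNReal.ofReal u :=
    calc ENNReal.ofReal l + 4⁻¹ * I ≤ E₀ + 4⁻¹ * I := add_le_add hl le_rfl
      _ = E := hE.symm
      _ ≤ ENNReal.ofReal u := hu
  have h2 : 4⁻¹ * I ≤ ENNReal.ofReal (u - l) :=
    (ENNReal.le_sub_of_add_le_left ENNReal.ofReal_ne_top h1).trans (ofReal_sub_ofReal_le u l)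
  calc I = 4 * (4⁻¹ * I) := by
        rw [← mul_assoc, ENNReal.mul_inv_cancel (by norm_num) (by norm_num), one_mul]
    _ ≤ 4 * ENNReal.ofReal (u - l) := by gcongr
    _ = ENNReal.ofReal (4 * (u - l)) := by
        rw [ENNReal.ofReal_mul zero_le_four, ENNReal.ofReal_ofNat]

/-- The final scalar inequality: with `0 ≤ x ≤ 1/16`, `x ≤ s`, `0 ≤ ρ₁ ≤ ρ`, `0 ≤ a, N`,
`4·[(1 + x)·4πρ₁a(1 + 12x)N - 4πρa(1 - C s)N] ≤ 16π(14 + C)·ρ a s N`. [folklore] -/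
theorem scalar_gap_bound {x s ρ ρ₁ a N : ℝ} (C : ℝ) (hx0 : 0 ≤ x) (hx : x ≤ 1 / 16) (hxs : x ≤ s)
    (hρ₁0 : 0 ≤ ρ₁) (hρ₁ : ρ₁ ≤ ρ) (ha : 0 ≤ a) (hN : 0 ≤ N) :
    4 * ((1 + x) * (4 * Real.pi * ρ₁ * a * (1 + 12 * x) * N) -
        4 * Real.pi * ρ * a * (1 - C * s) * N) ≤
      16 * Real.pi * (14 + C) * ρ * a * s * N := by
  have hρ : 0 ≤ ρ := hρ₁0.trans hρ₁
  have hπ : 0 ≤ Real.pi := Real.pi_pos.le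
  have hP : 0 ≤ 4 * Real.pi * a * N := by positivity
  have h1 : (1 + x) * (4 * Real.pi * ρ₁ * a * (1 + 12 * x) * N) =
      ((1 + x) * (1 + 12 * x)) * ρ₁ * (4 * Real.pi * a * N) := by ring
  have h2 : ((1 + x) * (1 + 12 * x)) * ρ₁ * (4 * Real.pi * a * N) ≤
      ((1 + x) * (1 + 12 * x)) * ρ * (4 * Real.pi * a * N) :=
    mul_le_mul_of_nonneg_right (mul_le_mul_of_nonneg_left hρ₁ (by positivity)) hP
  have hxx : x * x ≤ x * (1 / 16) := mul_le_mul_of_nonneg_left hx hx0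
  have h3 : (1 + x) * (1 + 12 * x) ≤ 1 + 14 * s := by nlinarith
  have h4 : ((1 + x) * (1 + 12 * x)) * ρ * (4 * Real.pi * a * N) ≤
      (1 + 14 * s) * ρ * (4 * Real.pi * a * N) :=
    mul_le_mul_of_nonneg_right (mul_le_mul_of_nonneg_right h3 hρ) hP
  have h5 : 4 * Real.pi * ρ * a * (1 - C * s) * N = (1 - C * s) * ρ * (4 * Real.pi * a * N) := by
    ring
  have h6 : 16 * Real.pi * (14 + C) * ρ * a * s * N =
      4 * ((1 + 14 * s) * ρ * (4 * Real.pi * a * N) - (1 - C * s) * ρ * (4 * Real.pi * a * N)) := by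
    ring
  rw [h1, h5, h6]
  linarith

/-! ### The case `a = 0` -/

/-- The Jastrow product of the trivial profile `φ ≡ 1` is `1`. [folklore] -/
theorem jastrow_one {N : ℕ} (L : ℝ) (S : Finset (Fin N)) (X : Config N) :
    jastrow L (fun _ => (1 : ℝ)) S X = 1 := by
  unfold jastrow pairFactor
  exact Finset.prod_eq_one fun _ _ => rfl

/-- For `v = 0` a.e. (as `x ↦ v(|x|)`) and `N ≥ 2`, `L > 0`: the periodic ground-state energy
vanishes (product state with `φ ≡ 1`). [cite: LSSY2005, Thm. 2.2, proof (the case `a = 0`)] -/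
theorem periodicGroundStateEnergy_eq_zero_of_ae {v : ℝ → ℝ≥0∞} (hvm : Measurable v)
    (hv0 : ∀ᵐ x : Space, v ‖x‖ = 0) {N : ℕ} {L : ℝ} (hN : 2 ≤ N) (hL : 0 < L) :
    periodicGroundStateEnergy v N L = 0 := by
  -- adapted from `LSSY2005_upperBound_periodic_of_layers` (PeriodicBoseGasUpperBound.lean)
  have hβ : 0 < L / 4 := by positivity
  have hβL : 2 * (L / 4) < L := by linarith
  have h := LSSY2005_jastrowBound_holds v hvm N L (L / 4) hN hL hβ hβL (fun _ => 1)
    (isPairProfile_one _) 0 0 0 le_rfl le_rfl le_rfl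
    (by rw [profileEnergy_one_eq_zero hv0]; exact bot_le) (by simp) (by simp)
    (by simp only [mul_zero]; positivity)
  simpa using h

/-- **The case `a = 0` of `TrialDriftFisherBound`** at fixed `N ≥ 2`, `L > 0`: if `v(|x|) = 0`
a.e., every exact real positive periodic minimiser `Ψ₀` is constant, and the (constant) Jastrow
state with `φ ≡ 1` has zero relative Fisher information with respect to it. [folklore] -/
theorem case_zero {v : ℝ → ℝ≥0∞} (hvm : Measurable v) (hv0 : ∀ᵐ x : Space, v ‖x‖ = 0) {N : ℕ}
    {L : ℝ} (hN : 2 ≤ N) (hL : 0 < L) (Ψ₀ : PeriodicTrialState N L)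
    (hmin : periodicEnergy v Ψ₀ = periodicGroundStateEnergy v N L)
    (hpos : ∀ X, Ψ₀.ψ X = ((Ψ₀.ψ X).re : ℂ) ∧ 0 < (Ψ₀.ψ X).re) :
    ∃ (Φ : PeriodicTrialState N L) (b c : ℝ) (φ : Space → ℝ), IsPairProfile b φ ∧ 0 < c ∧
      (∀ X, Φ.ψ X = ((c * jastrow L φ Finset.univ X : ℝ) : ℂ)) ∧
      relativeFisherInformation (cellN N L) (fun X => (Φ.ψ X).re) (fun X => (Ψ₀.ψ X).re) = 0 := by
  classical
  -- the minimiser has zero energy, hence zero kinetic energy, hence is constant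
  have hE0 : periodicGroundStateEnergy v N L = 0 := periodicGroundStateEnergy_eq_zero_of_ae hvm hv0 hN hL
  have hkin : ∫⁻ X in cellN N L, kineticDensity Ψ₀.ψ X = 0 := by
    refine le_antisymm ?_ bot_le
    calc ∫⁻ X in cellN N L, kineticDensity Ψ₀.ψ X ≤ periodicEnergy v Ψ₀ :=
          lintegral_mono fun X => le_self_add
      _ = 0 := by rw [hmin, hE0]
  obtain ⟨c₀, hc₀⟩ := exists_eq_const_of_kinetic_zero hL Ψ₀ hkin
  -- the trivial Jastrow state
  have hβ : 0 < L / 4 := by positivity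
  have hβL : 2 * (L / 4) < L := by linarith
  have hφ := isPairProfile_one (L / 4)
  have hν : 0 < jastrowNormR L (fun _ => (1 : ℝ)) (Finset.univ : Finset (Fin N)) :=
    hφ.jastrowNormR_pos hL hβL le_rfl (by simp) (by simp only [mul_zero]; positivity) Finset.univ
  set c : ℝ := (Real.sqrt (jastrowNormR L (fun _ => (1 : ℝ)) (Finset.univ : Finset (Fin N))))⁻¹
    with hc
  have hcpos : 0 < c := by positivity
  refine ⟨hφ.trialState hL hβL hν, L / 4, c, fun _ => 1, hφ, hcpos,
    fun X => trialState_apply hφ hL hβL hν X, ?_⟩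
  -- two constants have zero relative Fisher information
  have hΦre : ∀ X, ((hφ.trialState hL hβL hν).ψ X).re = c := fun X => by
    rw [trialState_apply hφ hL hβL hν X, jastrow_one, mul_one, Complex.ofReal_re]
  have hΨre : ∀ X, (Ψ₀.ψ X).re = c₀.re := fun X => by rw [hc₀ X]
  have hc₀0 : c₀.re ≠ 0 := by
    have := (hpos 0).2
    rw [hΨre] at this
    exact this.ne'
  refine relativeFisherInformation_of_eq_const_mul (cellN N L) (c := c / c₀.re) (fun X => ?_)
    (fun X => by rw [hΨre]; exact hc₀0)
  rw [hΦre, hΨre, div_mul_cancel₀ _ hc₀0]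

/-! ### The main theorem -/

/-- **`TrialDriftFisherBound`** (support item stmt-AtomisticToContinuum-14306 of route
`BECFisherTransfer`): for every repulsive finite-range `v` there are `ρ₀ > 0` and `C` such that for
`0 < ρ < ρ₀`, eventually in `N`, every exact real positive periodic minimiser `Ψ₀` on the torus of
side `(N/ρ)^{1/3}` admits a normalised periodic trial state of Bijl–Dyson–Jastrow form
`Φ = c·∏_{i<j} φ^per(xᵢ - xⱼ)` with `I_{cell^N}(P_Φ‖P_Ψ₀) ≤ C·ρa·(4πρa³/3)^{1/17}·N` — the
conditional one-body drift of the LSSY trial state is `L²(P_Φ)`-close to the true one. Proof: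
ground-state representation (`I = 4(E(Φ) - E₀^per)`) + Dyson–LSSY upper bound for the explicit
Jastrow state + LSSY Thm. 2.4 lower bound; `a = 0` separately (`case_zero`).
[cite: LSSY2005, Thm. 2.2 (2.14), Thm. 2.4 (2.35), (6.26)–(6.28); Dyson1957; OttoVillani2000, §1] -/
theorem trialDriftFisherBound_proof :
    Summit.AtomisticToContinuum.BoseEinsteinCondensation.Theses.BECFisherTransfer.TrialDriftFisherBound := by
  intro v hv
  obtain ⟨hvm, R₀, hR⟩ := hv
  -- the scattering length is finite (finite range)
  have hR' : ∀ r, max R₀ 0 < r → v r = 0 := fun r hr => hR r ((le_max_left _ _).trans_lt hr)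
  have haT : scatteringLength v ≠ ⊤ :=
    ne_top_of_le_ne_top ENNReal.ofReal_ne_top (scatteringLength_le_range (le_max_right R₀ 0) hR')
  -- sideLength ρ N → ∞
  have hLtend : ∀ {ρ : ℝ}, 0 < ρ → Tendsto (fun N : ℕ => sideLength ρ N) atTop atTop := by
    intro ρ hρ
    show Tendsto (fun N : ℕ => ((N : ℝ) / ρ) ^ (1 / 3 : ℝ)) atTop atTop
    exact (tendsto_rpow_atTop (by norm_num)).comp (tendsto_natCast_atTop_atTop.atTop_div_const hρ)
  rcases eq_or_ne (scatteringLength v) 0 with ha0 | ha0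
  · /- the free case `a = 0` -/
    have hv0 : ∀ᵐ x : Space, v ‖x‖ = 0 := LSSY2005_zeroScatteringLength_holds v R₀ hvm hR ha0
    refine ⟨1, one_pos, 0, fun ρ hρ _ => ?_⟩
    filter_upwards [eventually_ge_atTop 2, (hLtend hρ).eventually_gt_atTop 0] with N hN hL
    intro Ψ₀ hmin hpos
    obtain ⟨Φ, b, c, φ, hφ, hc, hΦ, hI⟩ := case_zero hvm hv0 hN hL Ψ₀ hmin hpos
    exact ⟨Φ, b, c, φ, hφ, hc, hΦ, hI.le.trans bot_le⟩
  · /- the interacting case `a > 0` -/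
    have ha0' : 0 < scatteringLength v := pos_iff_ne_zero.mpr ha0
    set a := (scatteringLength v).toReal with ha_def
    have ha : 0 < a := ENNReal.toReal_pos ha0'.ne' haT
    -- the two LSSY bounds
    obtain ⟨δ, C, C', hδ, -, hC', hLB⟩ := LSSY2005_lowerBound_periodic_holds v ⟨hvm, R₀, hR⟩ haT
    obtain ⟨b₀, hab₀, hUB⟩ := exists_jastrow_periodicEnergy_le hvm hR haT ha0'
    have hb₀ : 0 < b₀ := ha.trans hab₀
    -- the density threshold
    set Ym : ℝ := min (min δ 1) (min ((1 / 16 : ℝ) ^ 3) ((a / (4 * b₀)) ^ 3)) with hYm_def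
    have hYm : 0 < Ym := lt_min (lt_min hδ one_pos) (lt_min (by norm_num) (by positivity))
    refine ⟨3 * Ym / (4 * Real.pi * a ^ 3), by positivity, 16 * Real.pi * (14 + C),
      fun ρ hρ hρlt => ?_⟩
    -- the small parameter `Y = 4πρa³/3 < Ym`
    set Y : ℝ := 4 * Real.pi * ρ * a ^ 3 / 3 with hY_def
    have hY0 : 0 < Y := by positivity
    have hYlt : Y < Ym := by
      have h1 : Y = ρ * (4 * Real.pi * a ^ 3 / 3) := by rw [hY_def]; ring
      have h2 : Ym = 3 * Ym / (4 * Real.pi * a ^ 3) * (4 * Real.pi * a ^ 3 / 3) := by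
        field_simp
      rw [h1, h2]
      exact mul_lt_mul_of_pos_right hρlt (by positivity)
    have hYδ : Y < δ := hYlt.trans_le ((min_le_left _ _).trans (min_le_left _ _))
    have hY1 : Y ≤ 1 := (hYlt.trans_le ((min_le_left _ _).trans (min_le_right _ _))).le
    have hY16 : Y ^ ((1 : ℝ) / 3) ≤ 1 / 16 := by
      have h : Y < (1 / 16 : ℝ) ^ 3 := hYlt.trans_le ((min_le_right _ _).trans (min_le_left _ _))
      have := Real.rpow_le_rpow hY0.le h.le (by norm_num : (0 : ℝ) ≤ 1 / 3)
      rwa [cube_rpow_third (by norm_num)] at this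
    have hYb₀ : Y ^ ((1 : ℝ) / 3) ≤ a / (4 * b₀) := by
      have h : Y < (a / (4 * b₀)) ^ 3 := hYlt.trans_le ((min_le_right _ _).trans (min_le_right _ _))
      have := Real.rpow_le_rpow hY0.le h.le (by norm_num : (0 : ℝ) ≤ 1 / 3)
      rwa [cube_rpow_third (by positivity)] at this
    have hY3le17 : Y ^ ((1 : ℝ) / 3) ≤ Y ^ ((1 : ℝ) / 17) :=
      Real.rpow_le_rpow_of_exponent_ge hY0 hY1 (by norm_num)
    -- eventually in `N`: `N ≥ 2` and `L > a C' Y^{-6/17}`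
    filter_upwards [eventually_ge_atTop 2,
      (hLtend hρ).eventually_gt_atTop (a * (C' * Y ^ (-(6 : ℝ) / 17)))] with N hN2 hNL
    set L := sideLength ρ N with hL_def
    intro Ψ₀ hmin hpos
    have haC : 0 < a * (C' * Y ^ (-(6 : ℝ) / 17)) := by positivity
    have hL : 0 < L := haC.trans hNL
    have hN0 : 0 < N := by omega
    have hρL : (N : ℝ) / L ^ 3 = ρ := div_sideLength_pow_three hρ hN0
    have hN2' : (2 : ℝ) ≤ N := by exact_mod_cast hN2
    have hL3 : 0 < L ^ 3 := by positivity
    -- `ρ₁ = (N-1)/L³ ≤ ρ` and `x = a/b ≤ Y^{1/3}`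
    set ρ₁ : ℝ := ((N : ℝ) - 1) / L ^ 3 with hρ₁_def
    have hρ₁0 : 0 < ρ₁ := div_pos (by linarith) hL3
    have hρ₁ρ : ρ₁ ≤ ρ := by
      rw [← hρL, hρ₁_def]
      exact div_le_div_of_nonneg_right (by linarith) hL3.le
    have ht₁ : 0 < 4 * Real.pi * ρ₁ / 3 := by positivity
    have ht : 0 < 4 * Real.pi * ρ / 3 := by positivity
    set b : ℝ := (4 * Real.pi * ρ₁ / 3) ^ (-(1 : ℝ) / 3) with hb_def
    have hb : 0 < b := Real.rpow_pos_of_pos ht₁ _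
    have hxY : a / b ≤ Y ^ ((1 : ℝ) / 3) := by
      have hb' : b = ((4 * Real.pi * ρ₁ / 3) ^ ((1 : ℝ) / 3))⁻¹ := by
        rw [hb_def, show (-(1 : ℝ) / 3) = -((1 : ℝ) / 3) by ring, Real.rpow_neg ht₁.le]
      rw [hb', div_inv_eq_mul]
      calc a * (4 * Real.pi * ρ₁ / 3) ^ ((1 : ℝ) / 3)
          ≤ a * (4 * Real.pi * ρ / 3) ^ ((1 : ℝ) / 3) := by
            refine mul_le_mul_of_nonneg_left (Real.rpow_le_rpow ht₁.le ?_ (by norm_num)) ha.le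
            exact div_le_div_of_nonneg_right (by nlinarith [Real.pi_pos]) (by norm_num)
        _ = (a ^ 3) ^ ((1 : ℝ) / 3) * (4 * Real.pi * ρ / 3) ^ ((1 : ℝ) / 3) := by
            rw [cube_rpow_third ha.le]
        _ = Y ^ ((1 : ℝ) / 3) := by
            rw [← Real.mul_rpow (by positivity) ht.le, hY_def]
            ring_nf
    have hx0 : 0 ≤ a / b := by positivity
    have hxcond : a / b ≤ min (1 / 16) (a / (4 * b₀)) := le_min (hxY.trans hY16) (hxY.trans hYb₀)
    -- the explicit Jastrow trial state and its energy
    obtain ⟨Φ, β, c, φ, hφ, hc, hΦform, hEΦ⟩ := hUB N L hN2 hL hxcond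
    have hΦre : ∀ X, Φ.ψ X = ((Φ.ψ X).re : ℂ) := fun X => by rw [hΦform X, Complex.ofReal_re]
    -- finiteness of the ground-state energy, and the ground-state representation
    have hfin : periodicEnergy v Ψ₀ ≠ ⊤ := by
      rw [hmin]
      exact ne_top_of_le_ne_top (ne_top_of_le_ne_top ENNReal.ofReal_ne_top hEΦ)
        (periodicGroundStateEnergy_le v Φ)
    have hGSR := periodicEnergy_eq_add_relativeFisherInformation hvm Ψ₀ Φ hmin hfin hpos hΦre
    -- the lower bound at side `L`
    have hLB' := hLB N L hL
    dsimp only at hLB'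
    rw [hρL] at hLB'
    have hcond : C' * Y ^ (-(6 : ℝ) / 17) < L / a := by
      rw [lt_div_iff₀ ha]
      linarith
    have hLB'' := hLB' hYδ hcond
    -- assemble
    refine ⟨Φ, β, c, φ, hφ, hc, hΦform, ?_⟩
    refine (fisher_le_of_sandwich hGSR hLB'' hEΦ).trans (ENNReal.ofReal_le_ofReal ?_)
    exact scalar_gap_bound C hx0 (hxY.trans hY16) (hxY.trans hY3le17) hρ₁0.le hρ₁ρ ha.le
      (Nat.cast_nonneg N)

end TrialDriftFisher

end Summit.AtomisticToContinuum.BoseEinsteinCondensation.Theorems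

end
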